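import Summits.CriticalPhenomena.PercolationContinuityZ3.Theorems.PercNearOneGluingNoHeavyRsw3VolumeMomentBounds
import Summits.CriticalPhenomena.PercolationContinuityZ3.Theorems.PercNearOneGluingNoHeavyRsw3VolumePointSums
import Summits.CriticalPhenomena.PercolationContinuityZ3.Theorems.PercNearOneGluingNoHeavyRsw3VolumeMomentTools
import Summits.CriticalPhenomena.PercolationContinuityZ3.Theorems.PercAnnulusCrossingIICPlanarKesten
import HarnessLib

/-!
# RSW3 lane (P2, gen 21): KESTEN'S THEOREM (8) IN ALL MOMENTS, V — at `p_c(ℤ^d)` under (A2)□: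
# `E_{p_c}|C(0) ∩ Λ(n)|^t ≍ (n^d π_{p_c}(n))^t · π_{p_c}(n)` for EVERY `t ≥ 1` (the single gap exponent), `ℤ²` unconditional

builds on p205010 (kernel theorem, internal audit signed; external expert review pending) — NOT used in this file.

Cell `prim-rsw3`, prover seat `prim-rsw3-p2` (gen 21), memo `run/shared/lean/prim/rsw3/P2-RSWLITE.md` §28.
Support file (`--supports stmt-CriticalPhenomena-4575`); no definitions, no named facts, no sorries.

Write `V_n = |C(0) ∩ Λ(n)| = #{z ∈ Λ(n) : 0 ↔ z}`, `s(n) = n^d π(n)`.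

* §1 (every `p > 0` under (R1), (R_lin), (R2), `π(1) > 0`) **`exists_sum_real_iInter_openConn_le`**:
  `Σ_{q : Fin (t+1) → Λ(n)} P_p(⋂_i {0 ↔ q_i}) ≤ C_t (n^dπ(n))^{t+1} π(n)` (parts IV-a/IV-b), and the arm-weighted form
  `exists_sum_real_iInter_openConn_inter_arm_le` (`· P_p(Λ(2n+1) ↔ ∂ⁱⁿΛ(M))`); the `t`-th moment IS this sum (part V-a).
* §3 **`exists_integral_volume_pow_le_of_setToSetQuasiMultAspectAt`**: (A2)□ at `p_c(ℤ^d)` ⇒ `∀ t ∃ C ∀ n ≥ 1, E_{p_c} V_n^{t+1} ≤ C s(n)^{t+1} π(n)`;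
  **`exists_integral_volume_pow_two_sided_of_setToSetQuasiMultAspectAt`**: with gen 19's fat clusters (`c π(n) ≤ P(λ s(n) ≤ V_n)`) the
  matching lower bound — **`E_{p_c}|C(0) ∩ Λ(n)|^{t+1} ≍ (n^d π(n))^{t+1} π(n)` for every `t`**: all "gap exponents" of the critical cluster
  volume coincide (`E V^{t+1}/E V^t ≍ s(n)`), the finite-size form of `Δ_t = Δ` (Kesten 1986 Thm. (8) / Nguyen 1988, planar; BCKS 1999).
* §3b **`exists_setIntegral_volume_pow_arm_two_sided_of_setToSetQuasiMultAspectAt`** — conditioned on the arm to `∂ⁱⁿΛ(⌊n/2⌋)`: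
  `E_{p_c}[V_n^{t+1}; 0 ↔ ∂ⁱⁿΛ(⌊n/2⌋)] ≍ s(n)^{t+1} π(⌊n/2⌋)`, i.e. `E[(V_n/s(n))^{t+1} | arm] ≍ 1` for every `t` ((A2)□ alone).
* §4 **`exists_real_volume_ge_inter_arm_le_of_setToSetQuasiMultAspectAt`** — super-polynomial conditional upper tail: for every `t`,
  `P_{p_c}(λ s(n) ≤ V_n, 0 ↔ ∂ⁱⁿΛ(M)) ≤ C_t λ^{−(t+1)} π_{p_c}(M)` (`λ > 0`, `M ≥ 2n+1`): given a long arm, `V_n/s(n)` has all moments.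
* §5 `ℤ²` at `p_c = 1/2`, UNCONDITIONALLY (planar (A2)□ from RSW, p1): `exists_integral_volume_pow_two_sided_Z2` — Kesten's (8) for `P_cr`.

References: H. Kesten, Probab. Theory Relat. Fields 73 (1986) 369–394, Thm. (8) and Remark (37) [Kesten1986]; B. G. Nguyen, J. Stat.
Phys. 50 (1988); C. Borgs, J. Chayes, H. Kesten, J. Spencer, Random Structures Algorithms 15 (1999), §1 [BorgsChayesKestenSpencer1999];
D. Basu, A. Sapozhnikov, ECP 22 (2017), §1 (A2) [BasuSapozhnikov2017ECP]. [folklore]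
-/

noncomputable section

namespace Summit.CriticalPhenomena.PercolationContinuityZ3.Theorems

namespace Rsw3

open MeasureTheory Literature.Probability.LatticeModels Literature.Probability.Percolation
open SurfaceTension Crossing SimpleGraph Finset

variable {d : ℕ}

/-! ## §1 The `t`-point sums (every `p`) -/

/-- **THE `t`-POINT SUMS ARE BOUNDED BY `(n^d π(n))^t π(n)`** (every `p > 0`, `d ≥ 1`, (R1), (R_lin), (R2), `π(1) > 0`): for every
`t` there is `C_t > 0` with, for all `n ≥ 1`,
`Σ_{q : Fin (t+1) → Λ(n)} P_p(⋂_i {0 ↔ q_i}) ≤ C_t · (n^d π_p(n))^{t+1} · π_p(n)` —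
i.e. `E_p|C(0) ∩ Λ(n)|^{t+1} ≤ C_t (n^d π_p(n))^{t+1} π_p(n)` (the sum is the moment: part V).  Kesten's Theorem (8), upper half,
for every moment, in every dimension, under the one-arm ratio inequalities. [cite: Kesten1986, Thm. (8)]
[cite: BorgsChayesKestenSpencer1999, §1 (hyperscaling relations)] -/
theorem exists_sum_real_iInter_openConn_le (hd : 1 ≤ d) (p : unitInterval) (hp : 0 < (p : ℝ)) {A A' B : ℝ} (hA : 0 ≤ A)
    (hA' : 0 ≤ A')
    (hR1 : ∀ j n : ℕ, 1 ≤ j → j ≤ n →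
      oneArmProb d p j ^ 2 * ((j : ℝ) / (16 * n)) ^ (d - 1) ≤ A * oneArmProb d p n ^ 2)
    (hRlin : ∀ j n : ℕ, 1 ≤ j → j ≤ n →
      oneArmProb d p j * ((j : ℝ) / (4 * n)) ^ (d - 1) ≤ A' * oneArmProb d p n)
    (hR2 : ∀ j n : ℕ, 1 ≤ j → j ≤ n → n ≤ 8 * j → oneArmProb d p j ≤ B * oneArmProb d p n)
    (hπ1 : 0 < oneArmProb d p 1) (t : ℕ) :
    ∃ C : ℝ, 0 < C ∧ ∀ n : ℕ, 1 ≤ n →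
      ∑ q ∈ Fintype.piFinset (fun _ : Fin (t + 1) => box d n),
          (bondPercolation (zdGraph d) p).real (⋂ i, (openConn (0 : Site d) (q i) : Set (BondConfig (Site d)))) ≤
        C * (((n : ℝ) ^ d * oneArmProb d p n) ^ (t + 1) * oneArmProb d p n) := by
  obtain ⟨C, hC, hCle⟩ := exists_sum_piFinset_weight_le hd p hp hA hA' hR1 hRlin hR2 hπ1 t
  exact ⟨C, hC, fun n hn => (Finset.sum_le_sum fun q _ => real_iInter_openConn_le_weight hd p q).trans (hCle n hn)⟩

/-- **THE `t`-POINT SUMS WITH THE EXTERIOR ARM** (every `p > 0`, `d ≥ 1`, (R1), (R_lin), (R2), `π(1) > 0`): for every `t` there is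
`C_t > 0` with, for all `n ≥ 1` and `M ≥ 2n+1`,
`Σ_{q : Fin (t+1) → Λ(n)} P_p(⋂_i {0 ↔ q_i} ∩ {0 ↔ ∂ⁱⁿΛ(M)}) ≤ C_t · (n^dπ(n))^{t+1} π(n) · P_p(Λ(2n+1) ↔ ∂ⁱⁿΛ(M) in Λ(M))` —
`E_p[|C(0) ∩ Λ(n)|^{t+1}; 0 ↔ ∂ⁱⁿΛ(M)]` factorises through the annulus `Λ(M) ∖ Λ(2n)`; the IIC moments follow (part VI).
[cite: Kesten1986, Thm. (8), (41)–(46)] -/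
theorem exists_sum_real_iInter_openConn_inter_arm_le (hd : 1 ≤ d) (p : unitInterval) (hp : 0 < (p : ℝ)) {A A' B : ℝ}
    (hA : 0 ≤ A) (hA' : 0 ≤ A')
    (hR1 : ∀ j n : ℕ, 1 ≤ j → j ≤ n →
      oneArmProb d p j ^ 2 * ((j : ℝ) / (16 * n)) ^ (d - 1) ≤ A * oneArmProb d p n ^ 2)
    (hRlin : ∀ j n : ℕ, 1 ≤ j → j ≤ n →
      oneArmProb d p j * ((j : ℝ) / (4 * n)) ^ (d - 1) ≤ A' * oneArmProb d p n)
    (hR2 : ∀ j n : ℕ, 1 ≤ j → j ≤ n → n ≤ 8 * j → oneArmProb d p j ≤ B * oneArmProb d p n)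
    (hπ1 : 0 < oneArmProb d p 1) (t : ℕ) :
    ∃ C : ℝ, 0 < C ∧ ∀ n M : ℕ, 1 ≤ n → 2 * n + 1 ≤ M →
      ∑ q ∈ Fintype.piFinset (fun _ : Fin (t + 1) => box d n),
          (bondPercolation (zdGraph d) p).real
            ((⋂ i, (openConn (0 : Site d) (q i) : Set (BondConfig (Site d)))) ∩ siteToBoundary d M) ≤
        C * (((n : ℝ) ^ d * oneArmProb d p n) ^ (t + 1) * oneArmProb d p n) *
          (bondPercolation (zdGraph d) p).real (boxCrossing d (2 * n + 1) M) := by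
  obtain ⟨C, hC, hCle⟩ := exists_sum_piFinset_weight_le hd p hp hA hA' hR1 hRlin hR2 hπ1 t
  refine ⟨C, hC, fun n M hn hM => ?_⟩
  calc ∑ q ∈ Fintype.piFinset (fun _ : Fin (t + 1) => box d n), (bondPercolation (zdGraph d) p).real
          ((⋂ i, (openConn (0 : Site d) (q i) : Set (BondConfig (Site d)))) ∩ siteToBoundary d M)
      ≤ ∑ q ∈ Fintype.piFinset (fun _ : Fin (t + 1) => box d n),
          (∏ x ∈ insert (0 : Site d) (Finset.univ.image q),
            oneArmProb d p ((((Finset.erase (insert (0 : Site d) (Finset.univ.image q)) x).inf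
              (fun w => ((Site.supNorm (x - w) : ℕ) : ℕ∞))).toNat - 1) / 2)) *
            (bondPercolation (zdGraph d) p).real (boxCrossing d (2 * n + 1) M) :=
        Finset.sum_le_sum fun q hq => real_iInter_openConn_inter_siteToBoundary_le_weight_mul hd p hq hM
    _ = (∑ q ∈ Fintype.piFinset (fun _ : Fin (t + 1) => box d n),
          ∏ x ∈ insert (0 : Site d) (Finset.univ.image q),
            oneArmProb d p ((((Finset.erase (insert (0 : Site d) (Finset.univ.image q)) x).inf
              (fun w => ((Site.supNorm (x - w) : ℕ) : ℕ∞))).toNat - 1) / 2)) *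
            (bondPercolation (zdGraph d) p).real (boxCrossing d (2 * n + 1) M) := by rw [Finset.sum_mul]
    _ ≤ C * (((n : ℝ) ^ d * oneArmProb d p n) ^ (t + 1) * oneArmProb d p n) *
          (bondPercolation (zdGraph d) p).real (boxCrossing d (2 * n + 1) M) :=
        mul_le_mul_of_nonneg_right (hCle n hn) measureReal_nonneg

/-! ## §3 All moments of the critical cluster volume -/

open Classical in
/-- **ALL MOMENTS OF THE CRITICAL CLUSTER VOLUME, UPPER BOUND, UNDER (A2)□** (`p_c(ℤ^d)`, `d ≥ 2`, (A2)□ at `(s,L)`, `2 ≤ s ≤ L`, `ϰ > 0`):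
for every `t` there is `C > 0` with, for all `n ≥ 1`,
`E_{p_c}|C(0) ∩ Λ(n)|^{t+1} ≤ C · (n^d π_{p_c}(n))^{t+1} · π_{p_c}(n)`. [cite: Kesten1986, Thm. (8)] [cite: BasuSapozhnikov2017ECP, §1 assumption (A2)] -/
theorem exists_integral_volume_pow_le_of_setToSetQuasiMultAspectAt (hd : 2 ≤ d) {s L : ℕ} (hs : 2 ≤ s) (hsL : s ≤ L) {ϰ : ℝ}
    (hϰ : 0 < ϰ) (h : SetToSetQuasiMultAspectAt d (criticalProbI d) s L ϰ) (t : ℕ) :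
    ∃ C : ℝ, 0 < C ∧ ∀ n : ℕ, 1 ≤ n →
      ∫ ω, ((((box d n).filter fun z => ω ∈ (openConn (0 : Site d) z : Set (BondConfig (Site d)))).card : ℕ) : ℝ) ^ (t + 1)
          ∂(bondPercolation (zdGraph d) (criticalProbI d)) ≤
        C * (((n : ℝ) ^ d * oneArmProb d (criticalProbI d) n) ^ (t + 1) * oneArmProb d (criticalProbI d) n) := by
  have hd1 : 1 ≤ d := by omega
  obtain ⟨A, A', B, hA, hA', hR1, hRlin, hR2, hpc, hπ1⟩ := exists_ratios_of_setToSetQuasiMultAspectAt hd hs hsL hϰ h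
  obtain ⟨C, hC, hle⟩ := exists_sum_real_iInter_openConn_le hd1 (criticalProbI d) hpc hA hA' hR1 hRlin hR2 hπ1 t
  refine ⟨C, hC, fun n hn => ?_⟩
  rw [integral_card_filter_pow_eq_sum _ (box d n) _ (fun z _ => measurableSet_openConn_holds (0 : Site d) z) (t + 1)]
  exact hle n hn

open Classical in
/-- **KESTEN'S THEOREM (8) FOR `P_{p_c}`, ALL MOMENTS, TWO-SIDED — THE SINGLE GAP EXPONENT** (`p_c(ℤ^d)`, `d ≥ 2`, (A2)□ at `(s,L)`,
`2 ≤ s ≤ L`, `ϰ > 0`): for every `t` there are `0 < c ≤ C` with, for all `n ≥ 1`,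
`c · (n^d π(n))^{t+1} π(n) ≤ E_{p_c}|C(0) ∩ Λ(n)|^{t+1} ≤ C · (n^d π(n))^{t+1} π(n)`
— the lower bound is gen 19's fat-cluster theorem (`c π(n) ≤ P_{p_c}(λ(2n+1)^dπ(n) ≤ |C(0) ∩ Λ(n)|)`) and Markov.  Consequently
`E V_n^{t+2} / E V_n^{t+1} ≍ n^d π(n)` for every `t`: all gap exponents of the critical cluster volume coincide.
[cite: Kesten1986, Thm. (8)] [cite: BorgsChayesKestenSpencer1999, §1 (hyperscaling relations)] [cite: BasuSapozhnikov2017ECP, §1 assumption (A2)] -/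
theorem exists_integral_volume_pow_two_sided_of_setToSetQuasiMultAspectAt (hd : 2 ≤ d) {s L : ℕ} (hs : 2 ≤ s) (hsL : s ≤ L)
    {ϰ : ℝ} (hϰ : 0 < ϰ) (h : SetToSetQuasiMultAspectAt d (criticalProbI d) s L ϰ) (t : ℕ) :
    ∃ c C : ℝ, 0 < c ∧ 0 < C ∧ ∀ n : ℕ, 1 ≤ n →
      c * (((n : ℝ) ^ d * oneArmProb d (criticalProbI d) n) ^ (t + 1) * oneArmProb d (criticalProbI d) n) ≤
        ∫ ω, ((((box d n).filter fun z => ω ∈ (openConn (0 : Site d) z : Set (BondConfig (Site d)))).card : ℕ) : ℝ) ^ (t + 1)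
          ∂(bondPercolation (zdGraph d) (criticalProbI d)) ∧
      ∫ ω, ((((box d n).filter fun z => ω ∈ (openConn (0 : Site d) z : Set (BondConfig (Site d)))).card : ℕ) : ℝ) ^ (t + 1)
          ∂(bondPercolation (zdGraph d) (criticalProbI d)) ≤
        C * (((n : ℝ) ^ d * oneArmProb d (criticalProbI d) n) ^ (t + 1) * oneArmProb d (criticalProbI d) n) := by
  classical
  obtain ⟨C, hC, hup⟩ := exists_integral_volume_pow_le_of_setToSetQuasiMultAspectAt hd hs hsL hϰ h t
  obtain ⟨lam, c, hlam, hc, hlow⟩ := exists_le_real_volume_ge_of_setToSetQuasiMultAspectAt hd hs hsL hϰ h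
  set μ := bondPercolation (zdGraph d) (criticalProbI d) with hμ
  refine ⟨lam ^ (t + 1) * c, C, by positivity, hC, fun n hn => ⟨?_, hup n hn⟩⟩
  have hπn : 0 ≤ oneArmProb d (criticalProbI d) n := measureReal_nonneg
  have hn0 : (0 : ℝ) ≤ n := Nat.cast_nonneg n
  set a : ℝ := lam * ((2 * (n : ℝ) + 1) ^ d * oneArmProb d (criticalProbI d) n) with ha
  have ha0 : 0 ≤ a := by rw [ha]; exact mul_nonneg hlam.le (mul_nonneg (pow_nonneg (by linarith) d) hπn)
  -- Markov for the `(t+1)`-st power on the fat event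
  have hmk := pow_mul_real_le_setIntegral_volume_pow μ n (t + 1) ha0 Set.univ
  rw [Set.inter_univ, Measure.restrict_univ] at hmk
  -- the fat-cluster lower bound, dropping the arm
  have hfat : c * oneArmProb d (criticalProbI d) n ≤ μ.real {ω | a ≤ ((((box d n).filter fun z =>
      ω ∈ (openConn (0 : Site d) z : Set (BondConfig (Site d)))).card : ℕ) : ℝ)} :=
    (hlow n hn).trans (measureReal_mono Set.inter_subset_left)
  -- `(n^d π)^{t+1} ≤ ((2n+1)^d π)^{t+1}`
  have hcmp : ((n : ℝ) ^ d * oneArmProb d (criticalProbI d) n) ^ (t + 1) ≤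
      ((2 * (n : ℝ) + 1) ^ d * oneArmProb d (criticalProbI d) n) ^ (t + 1) := by
    refine pow_le_pow_left₀ (mul_nonneg (pow_nonneg hn0 d) hπn) ?_ _
    exact mul_le_mul_of_nonneg_right (pow_le_pow_left₀ hn0 (by linarith) d) hπn
  calc lam ^ (t + 1) * c * (((n : ℝ) ^ d * oneArmProb d (criticalProbI d) n) ^ (t + 1) * oneArmProb d (criticalProbI d) n)
      ≤ lam ^ (t + 1) * c * (((2 * (n : ℝ) + 1) ^ d * oneArmProb d (criticalProbI d) n) ^ (t + 1) *
          oneArmProb d (criticalProbI d) n) :=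
        mul_le_mul_of_nonneg_left (mul_le_mul_of_nonneg_right hcmp hπn) (mul_nonneg (pow_nonneg hlam.le _) hc.le)
    _ = a ^ (t + 1) * (c * oneArmProb d (criticalProbI d) n) := by rw [ha, mul_pow]; ring
    _ ≤ a ^ (t + 1) * μ.real {ω | a ≤ ((((box d n).filter fun z =>
          ω ∈ (openConn (0 : Site d) z : Set (BondConfig (Site d)))).card : ℕ) : ℝ)} :=
        mul_le_mul_of_nonneg_left hfat (pow_nonneg ha0 _)
    _ ≤ _ := hmk

/-! ## §3b Conditioned on the arm to half the radius: all conditional moments of `V_n/s(n)` are `≍ 1` -/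

open Classical in
/-- The volume power `V_n^t` is integrable for every finite measure (it is bounded by `|Λ(n)|^t`). [folklore] -/
theorem integrable_volume_pow (μ : Measure (BondConfig (Site d))) [IsFiniteMeasure μ] (n t : ℕ) :
    Integrable (fun ω => ((((box d n).filter fun z =>
      ω ∈ (openConn (0 : Site d) z : Set (BondConfig (Site d)))).card : ℕ) : ℝ) ^ t) μ := by
  classical
  have hVm := (measurable_card_filter_openConn (d := d) n).pow_const t
  refine (integrable_const (((box d n).card : ℝ) ^ t)).mono' hVm.aestronglyMeasurable (Filter.Eventually.of_forall fun ω => ?_)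
  have h0 : (0 : ℝ) ≤ ((((box d n).filter fun z =>
      ω ∈ (openConn (0 : Site d) z : Set (BondConfig (Site d)))).card : ℕ) : ℝ) := Nat.cast_nonneg _
  rw [Real.norm_eq_abs, abs_of_nonneg (pow_nonneg h0 t)]
  exact pow_le_pow_left₀ h0 (by exact_mod_cast Finset.card_filter_le _ _) t

open Classical in
/-- **CONDITIONAL KESTEN (8) IN FINITE VOLUME UNDER (A2)□** (`p_c(ℤ^d)`, `d ≥ 2`, (A2)□ at `(s,L)`, `2 ≤ s ≤ L`, `ϰ > 0`): for every `t`
there are `0 < c ≤ C` with, for all `n ≥ 2`,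
`c · (n^dπ(n))^{t+1} · π(⌊n/2⌋) ≤ E_{p_c}[|C(0) ∩ Λ(n)|^{t+1}; 0 ↔ ∂ⁱⁿΛ(⌊n/2⌋)] ≤ C · (n^dπ(n))^{t+1} · π(⌊n/2⌋)`,
i.e. **given the arm to half the radius, `E[(V_n/s(n))^{t+1} | 0 ↔ ∂ⁱⁿΛ(⌊n/2⌋)] ≍ 1` for every `t`** (upper: drop the arm, §3, and
`π(n) ≤ π(⌊n/2⌋)`; lower: gen 19's fat clusters WITH the arm, Markov, and `π(⌊n/2⌋) ≤ Bπ(n)`).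
[cite: Kesten1986, Thm. (8)] [cite: BasuSapozhnikov2017ECP, §1 assumption (A2)] -/
theorem exists_setIntegral_volume_pow_arm_two_sided_of_setToSetQuasiMultAspectAt (hd : 2 ≤ d) {s L : ℕ} (hs : 2 ≤ s)
    (hsL : s ≤ L) {ϰ : ℝ} (hϰ : 0 < ϰ) (h : SetToSetQuasiMultAspectAt d (criticalProbI d) s L ϰ) (t : ℕ) :
    ∃ c C : ℝ, 0 < c ∧ 0 < C ∧ ∀ n : ℕ, 2 ≤ n →
      c * (((n : ℝ) ^ d * oneArmProb d (criticalProbI d) n) ^ (t + 1) * oneArmProb d (criticalProbI d) (n / 2)) ≤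
        ∫ ω in siteToBoundary d (n / 2), ((((box d n).filter fun z =>
          ω ∈ (openConn (0 : Site d) z : Set (BondConfig (Site d)))).card : ℕ) : ℝ) ^ (t + 1)
          ∂(bondPercolation (zdGraph d) (criticalProbI d)) ∧
      ∫ ω in siteToBoundary d (n / 2), ((((box d n).filter fun z =>
          ω ∈ (openConn (0 : Site d) z : Set (BondConfig (Site d)))).card : ℕ) : ℝ) ^ (t + 1)
          ∂(bondPercolation (zdGraph d) (criticalProbI d)) ≤
        C * (((n : ℝ) ^ d * oneArmProb d (criticalProbI d) n) ^ (t + 1) * oneArmProb d (criticalProbI d) (n / 2)) := by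
  classical
  obtain ⟨C, hC, hup⟩ := exists_integral_volume_pow_le_of_setToSetQuasiMultAspectAt hd hs hsL hϰ h t
  obtain ⟨lam, c, hlam, hc, hlow⟩ := exists_le_real_volume_ge_of_setToSetQuasiMultAspectAt hd hs hsL hϰ h
  obtain ⟨A, A', B, hA, hA', hR1, hRlin, hR2, hpc, hπ1⟩ := exists_ratios_of_setToSetQuasiMultAspectAt hd hs hsL hϰ h
  have hB0 : 0 < B := by
    have h1 := hR2 1 1 le_rfl le_rfl (by norm_num)
    nlinarith
  set μ := bondPercolation (zdGraph d) (criticalProbI d) with hμ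
  refine ⟨lam ^ (t + 1) * c / B, C, by positivity, hC, fun n hn => ⟨?_, ?_⟩⟩
  · have hπn : 0 ≤ oneArmProb d (criticalProbI d) n := measureReal_nonneg
    have hn0 : (0 : ℝ) ≤ n := Nat.cast_nonneg n
    set a : ℝ := lam * ((2 * (n : ℝ) + 1) ^ d * oneArmProb d (criticalProbI d) n) with ha
    have ha0 : 0 ≤ a := by rw [ha]; exact mul_nonneg hlam.le (mul_nonneg (pow_nonneg (by linarith) d) hπn)
    have hmk := pow_mul_real_le_setIntegral_volume_pow μ n (t + 1) ha0 (siteToBoundary d (n / 2))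
    have hr2 : oneArmProb d (criticalProbI d) (n / 2) ≤ B * oneArmProb d (criticalProbI d) n :=
      hR2 (n / 2) n (by omega) (Nat.div_le_self n 2) (by omega)
    have hcmp : ((n : ℝ) ^ d * oneArmProb d (criticalProbI d) n) ^ (t + 1) ≤
        ((2 * (n : ℝ) + 1) ^ d * oneArmProb d (criticalProbI d) n) ^ (t + 1) := by
      refine pow_le_pow_left₀ (mul_nonneg (pow_nonneg hn0 d) hπn) ?_ _
      exact mul_le_mul_of_nonneg_right (pow_le_pow_left₀ hn0 (by linarith) d) hπn
    have hs0 : 0 ≤ ((n : ℝ) ^ d * oneArmProb d (criticalProbI d) n) ^ (t + 1) := pow_nonneg (mul_nonneg (pow_nonneg hn0 d) hπn) _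
    calc lam ^ (t + 1) * c / B * (((n : ℝ) ^ d * oneArmProb d (criticalProbI d) n) ^ (t + 1) * oneArmProb d (criticalProbI d) (n / 2))
        ≤ lam ^ (t + 1) * c / B * (((2 * (n : ℝ) + 1) ^ d * oneArmProb d (criticalProbI d) n) ^ (t + 1) *
            (B * oneArmProb d (criticalProbI d) n)) :=
          mul_le_mul_of_nonneg_left (mul_le_mul hcmp hr2 measureReal_nonneg (hs0.trans hcmp)) (by positivity)
      _ = a ^ (t + 1) * (c * oneArmProb d (criticalProbI d) n) := by
          rw [ha]
          field_simp
          ring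
      _ ≤ a ^ (t + 1) * μ.real ({ω | a ≤ ((((box d n).filter fun z =>
            ω ∈ (openConn (0 : Site d) z : Set (BondConfig (Site d)))).card : ℕ) : ℝ)} ∩ siteToBoundary d (n / 2)) :=
          mul_le_mul_of_nonneg_left (hlow n (by omega)) (pow_nonneg ha0 _)
      _ ≤ _ := hmk
  · have hanti : oneArmProb d (criticalProbI d) n ≤ oneArmProb d (criticalProbI d) (n / 2) :=
      DCT16.real_siteToBoundary_antitone _ (Nat.div_le_self n 2)
    have hs0 : 0 ≤ ((n : ℝ) ^ d * oneArmProb d (criticalProbI d) n) ^ (t + 1) :=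
      pow_nonneg (mul_nonneg (pow_nonneg (Nat.cast_nonneg n) d) measureReal_nonneg) _
    calc ∫ ω in siteToBoundary d (n / 2), ((((box d n).filter fun z =>
            ω ∈ (openConn (0 : Site d) z : Set (BondConfig (Site d)))).card : ℕ) : ℝ) ^ (t + 1) ∂μ
        ≤ ∫ ω, ((((box d n).filter fun z =>
            ω ∈ (openConn (0 : Site d) z : Set (BondConfig (Site d)))).card : ℕ) : ℝ) ^ (t + 1) ∂μ :=
          setIntegral_le_integral (integrable_volume_pow μ n (t + 1))
            (Filter.Eventually.of_forall fun ω => pow_nonneg (Nat.cast_nonneg _) _)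
      _ ≤ C * (((n : ℝ) ^ d * oneArmProb d (criticalProbI d) n) ^ (t + 1) * oneArmProb d (criticalProbI d) n) := hup n (by omega)
      _ ≤ C * (((n : ℝ) ^ d * oneArmProb d (criticalProbI d) n) ^ (t + 1) * oneArmProb d (criticalProbI d) (n / 2)) :=
          mul_le_mul_of_nonneg_left (mul_le_mul_of_nonneg_left hanti hs0) hC.le

/-! ## §4 Given a long arm, `V_n / s(n)` has all moments: super-polynomial conditional upper tail -/

open Classical in
/-- **SUPER-POLYNOMIAL CONDITIONAL UPPER TAIL OF THE VOLUME UNDER (A2)□** (`p_c(ℤ^d)`, `d ≥ 2`, (A2)□ at `(s,L)`, `2 ≤ s ≤ L`, `ϰ > 0`):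
for every `t` there is `C > 0` with, for all `n ≥ 1`, `M ≥ 2n + 1` and `λ > 0`,
`P_{p_c}(λ · n^d π(n) ≤ |C(0) ∩ Λ(n)|, 0 ↔ ∂ⁱⁿΛ(M)) ≤ C · λ^{−(t+1)} · π_{p_c}(M)`
— Markov on `E[V_n^{t+1}; 0 ↔ ∂ⁱⁿΛ(M)] ≤ C_t s(n)^{t+1} π(n) · P(Λ(2n+1) ↔ ∂ⁱⁿΛ(M))` (part IV-b) and one-arm quasi-multiplicativity
`c π(2n+1) P(Λ(2n+1) ↔ ∂ⁱⁿΛ(M)) ≤ π(M)`, `π(n) ≤ Bπ(2n+1)`.  Gen 19's `C/λ` tail (Markov on the mean) is the case `t = 0`.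
[cite: Kesten1986, Thm. (8)] [cite: BasuSapozhnikov2017ECP, §1 assumption (A2)] -/
theorem exists_real_volume_ge_inter_arm_le_of_setToSetQuasiMultAspectAt (hd : 2 ≤ d) {s L : ℕ} (hs : 2 ≤ s) (hsL : s ≤ L)
    {ϰ : ℝ} (hϰ : 0 < ϰ) (h : SetToSetQuasiMultAspectAt d (criticalProbI d) s L ϰ) (t : ℕ) :
    ∃ C : ℝ, 0 < C ∧ ∀ (n M : ℕ) (lam : ℝ), 1 ≤ n → 2 * n + 1 ≤ M → 0 < lam →
      (bondPercolation (zdGraph d) (criticalProbI d)).real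
          ({ω | lam * ((n : ℝ) ^ d * oneArmProb d (criticalProbI d) n) ≤
              ((((box d n).filter fun z => ω ∈ (openConn (0 : Site d) z : Set (BondConfig (Site d)))).card : ℕ) : ℝ)} ∩
            siteToBoundary d M) ≤
        C / lam ^ (t + 1) * oneArmProb d (criticalProbI d) M := by
  classical
  have hd1 : 1 ≤ d := by omega
  obtain ⟨A, A', B, hA, hA', hR1, hRlin, hR2, hpc, hπ1⟩ := exists_ratios_of_setToSetQuasiMultAspectAt hd hs hsL hϰ h
  obtain ⟨c, hc, hQM⟩ := oneArmQuasiMultAt_of_setToSetQuasiMultAspectAt hd hs hsL hϰ h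
  obtain ⟨C, hC, hle⟩ := exists_sum_real_iInter_openConn_inter_arm_le hd1 (criticalProbI d) hpc hA hA' hR1 hRlin hR2 hπ1 t
  have hB0 : 0 < B := by
    have h1 := hR2 1 1 le_rfl le_rfl (by norm_num)
    nlinarith
  set μ := bondPercolation (zdGraph d) (criticalProbI d) with hμ
  refine ⟨C * B / c, by positivity, fun n M lam hn hM hlam => ?_⟩
  have hπ : ∀ m, 0 < oneArmProb d (criticalProbI d) m := oneArmProb_pos hd1 _ hpc
  have hn0 : (0 : ℝ) < n := by exact_mod_cast hn
  set sn : ℝ := (n : ℝ) ^ d * oneArmProb d (criticalProbI d) n with hsn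
  have hsn0 : 0 < sn := mul_pos (pow_pos hn0 d) (hπ n)
  have ha0 : 0 ≤ lam * sn := (mul_pos hlam hsn0).le
  -- Markov on the arm event
  have hmk := pow_mul_real_le_setIntegral_volume_pow μ n (t + 1) ha0 (siteToBoundary d M)
  rw [setIntegral_card_filter_pow_eq_sum μ (box d n) _ (fun z _ => measurableSet_openConn_holds (0 : Site d) z)
    (siteToBoundary d M) (t + 1)] at hmk
  have hsum := hle n M hn hM
  -- quasi-multiplicativity: `π(n) · u(2n+1, M) ≤ (B/c) π(M)`
  have hqm : c * (oneArmProb d (criticalProbI d) (2 * n + 1) * μ.real (boxCrossing d (2 * n + 1) M)) ≤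
      oneArmProb d (criticalProbI d) M := hQM (2 * n + 1) M (by omega) hM
  have hr2 : oneArmProb d (criticalProbI d) n ≤ B * oneArmProb d (criticalProbI d) (2 * n + 1) := hR2 n (2 * n + 1) hn (by omega) (by omega)
  have hkey : oneArmProb d (criticalProbI d) n * μ.real (boxCrossing d (2 * n + 1) M) ≤ B / c * oneArmProb d (criticalProbI d) M := by
    have hu : 0 ≤ μ.real (boxCrossing d (2 * n + 1) M) := measureReal_nonneg
    rw [div_mul_eq_mul_div, le_div_iff₀ hc]
    calc oneArmProb d (criticalProbI d) n * μ.real (boxCrossing d (2 * n + 1) M) * c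
        ≤ B * oneArmProb d (criticalProbI d) (2 * n + 1) * μ.real (boxCrossing d (2 * n + 1) M) * c :=
          mul_le_mul_of_nonneg_right (mul_le_mul_of_nonneg_right hr2 hu) hc.le
      _ = B * (c * (oneArmProb d (criticalProbI d) (2 * n + 1) * μ.real (boxCrossing d (2 * n + 1) M))) := by ring
      _ ≤ B * oneArmProb d (criticalProbI d) M := mul_le_mul_of_nonneg_left hqm hB0.le
  -- assemble: `(λ s)^{t+1} P ≤ C s^{t+1} π(n) u ≤ C s^{t+1} (B/c) π(M)`
  have hchain : (lam * sn) ^ (t + 1) * μ.real ({ω | lam * sn ≤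
        ((((box d n).filter fun z => ω ∈ (openConn (0 : Site d) z : Set (BondConfig (Site d)))).card : ℕ) : ℝ)} ∩
          siteToBoundary d M) ≤ C * (sn ^ (t + 1) * (B / c * oneArmProb d (criticalProbI d) M)) :=
    calc _ ≤ _ := hmk
      _ ≤ C * (sn ^ (t + 1) * oneArmProb d (criticalProbI d) n) * μ.real (boxCrossing d (2 * n + 1) M) := hsum
      _ = C * (sn ^ (t + 1) * (oneArmProb d (criticalProbI d) n * μ.real (boxCrossing d (2 * n + 1) M))) := by ring
      _ ≤ C * (sn ^ (t + 1) * (B / c * oneArmProb d (criticalProbI d) M)) :=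
          mul_le_mul_of_nonneg_left (mul_le_mul_of_nonneg_left hkey (pow_nonneg hsn0.le _)) hC.le
  have hlt : 0 < (lam * sn) ^ (t + 1) := pow_pos (mul_pos hlam hsn0) _
  rw [mul_pow] at hchain hlt
  calc μ.real ({ω | lam * sn ≤ ((((box d n).filter fun z =>
          ω ∈ (openConn (0 : Site d) z : Set (BondConfig (Site d)))).card : ℕ) : ℝ)} ∩ siteToBoundary d M)
      = (lam ^ (t + 1) * sn ^ (t + 1) * μ.real ({ω | lam * sn ≤ ((((box d n).filter fun z =>
          ω ∈ (openConn (0 : Site d) z : Set (BondConfig (Site d)))).card : ℕ) : ℝ)} ∩ siteToBoundary d M)) /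
          (lam ^ (t + 1) * sn ^ (t + 1)) := by field_simp
    _ ≤ C * (sn ^ (t + 1) * (B / c * oneArmProb d (criticalProbI d) M)) / (lam ^ (t + 1) * sn ^ (t + 1)) :=
        div_le_div_of_nonneg_right hchain hlt.le
    _ = C * B / c / lam ^ (t + 1) * oneArmProb d (criticalProbI d) M := by
        field_simp

/-! ## §5 On `ℤ²` at `p_c = 1/2`, unconditionally -/

open Classical in
/-- **KESTEN'S THEOREM (8) FOR `P_cr` ON `ℤ²`, ALL MOMENTS, UNCONDITIONALLY**: for every `t` there are `0 < c, C` with, for all `n ≥ 1`,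
`c (n²π_{1/2}(n))^{t+1} π_{1/2}(n) ≤ E_{1/2}|C(0) ∩ Λ(n)|^{t+1} ≤ C (n²π_{1/2}(n))^{t+1} π_{1/2}(n)` — (A2)□ holds at `p_c(ℤ²) = 1/2` by
RSW (p1).  Kesten 1986, Remark (37)/(9): the `P_cr`-moments of `#(W ∩ S(n))`. [cite: Kesten1986, Thm. (8)] -/
theorem exists_integral_volume_pow_two_sided_Z2 (t : ℕ) :
    ∃ c C : ℝ, 0 < c ∧ 0 < C ∧ ∀ n : ℕ, 1 ≤ n →
      c * (((n : ℝ) ^ 2 * oneArmProb 2 (criticalProbI 2) n) ^ (t + 1) * oneArmProb 2 (criticalProbI 2) n) ≤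
        ∫ ω, ((((box 2 n).filter fun z => ω ∈ (openConn (0 : Site 2) z : Set (BondConfig (Site 2)))).card : ℕ) : ℝ) ^ (t + 1)
          ∂(bondPercolation (zdGraph 2) (criticalProbI 2)) ∧
      ∫ ω, ((((box 2 n).filter fun z => ω ∈ (openConn (0 : Site 2) z : Set (BondConfig (Site 2)))).card : ℕ) : ℝ) ^ (t + 1)
          ∂(bondPercolation (zdGraph 2) (criticalProbI 2)) ≤
        C * (((n : ℝ) ^ 2 * oneArmProb 2 (criticalProbI 2) n) ^ (t + 1) * oneArmProb 2 (criticalProbI 2) n) := by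
  obtain ⟨ϰ, hϰ, hA2⟩ := exists_setToSetQuasiMultAspectAt_two_of_criticalProbI_le
  exact exists_integral_volume_pow_two_sided_of_setToSetQuasiMultAspectAt (d := 2) le_rfl (by norm_num) (by norm_num) hϰ
    (hA2 _ le_rfl) t

end Rsw3

end Summit.CriticalPhenomena.PercolationContinuityZ3.Theorems
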